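import Summits.AtomisticToContinuum.HydrodynamicLimit.Theorems.MourreKoopmanChargesStressStrongMixingTorusStressTrigReduction
import HarnessLib

/-!
# `StressStrongMixing` · line `birth`, stub `stub_torusStressPairForm`:
# the finite-`N` Fourier/pair identity `M_N(s; Re e_n, Re e_n) + M_N(s; Im e_n, Im e_n) = P_N(s; Re e_n)`

Support file for the crux item stmt-AtomisticToContinuum-9584 (`StressStrongMixing`, route `MourreKoopmanCharges` of
`AtomisticToContinuum/HydrodynamicLimit`), line `birth` (`Cruxes/StressStrongMixing/Lines/birth.lean`), registered stub
`stub_torusStressPairForm` (B3form of lead c6's reshape 12).  With the torus two-time stress moment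
`M_N(s; χ₁, χ₂) := (N+1)·E_{G_N}[Π(χ₁)(Φ_{s_N} z)·Π(χ₂)(z)]`, `Π(χ)(z) = ∫ χ(y.1)·(y.2 0 * y.2 1) d(emp z)(y)
= (N+1)⁻¹ Σᵢ χ(xᵢ) vᵢ⁰vᵢ¹`, `s_N = s(N+1)^{-1/3}`, `G_N = localGibbsLaw σ 1 0 θ N (Φ N)`, and the two-time stress PAIR
FUNCTIONAL `P_N(s; f) := (N+1)·E_{G_N}[∫_y ∫_{y'} f(y.1 − y'.1) Π(y.2) Π(y'.2) d(emp z)(y') d(emp Φ_{s_N} z)(y)]`, the stub is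
the exact finite-`N` identity `M_N(s; Re e_n, Re e_n) + M_N(s; Im e_n, Im e_n) = P_N(s; Re e_n)` (`σ ≤ 1/2`, `θ > 0`,
every flow family, wavenumber `n ∈ ℤ³`, time `s` and `N`).  Pure bookkeeping:

* `mFourier_apply_neg_T3`, `re_mFourier_sub` — `e_n(−a) = conj e_n(a)` and the character identity
  `Re e_n(x − a) = Re e_n(x) Re e_n(a) + Im e_n(x) Im e_n(a)`;
* `stressPair_inner_eq`, `stressPair_eq_re_mul_re_add_im_mul_im` — pointwise in the configurations all empirical
  integrals are finite sums (`integral_empiricalMeasure`), so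
  `∫_y ∫_{y'} Re e_n(y.1 − y'.1) Π(y.2) Π(y'.2) d(emp z)(y') d(emp z')(y) = Π(Re e_n)(z') Π(Re e_n)(z) + Π(Im e_n)(z') Π(Im e_n)(z)`;
* `stub_torusStressPairForm` — integrate over `G_N` (`integral_add` with the landed integrability
  `integrable_stressField_flow_mul_of_continuous`).

References: H. Spohn, *Large Scale Dynamics of Interacting Particles* (1991), Part I §7.1 (7.6)–(7.7), (7.14)–(7.15);
L. Grafakos, *Classical Fourier Analysis* (2014), §3.1.1 (characters of `𝕋ᵈ`).
-/

noncomputable section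

open MeasureTheory ProbabilityTheory Filter Topology
open scoped InnerProductSpace ENNReal

namespace Summit.AtomisticToContinuum.HydrodynamicLimit.Theorems.MourreKoopmanChargesStressStrongMixing

open Literature.MathematicalPhysics.KineticTheory Literature.Analysis.FluidPDE

/-! ### The character identity `Re e_n(x − a) = Re e_n(x) Re e_n(a) + Im e_n(x) Im e_n(a)` -/

section Character

open UnitAddTorus

/-- The characters of `𝕋³` at a negated argument: `e_n(−a) = conj e_n(a)` (`= e_{−n}(a)`, Mathlib `mFourier_neg`).
[folklore] -/
theorem mFourier_apply_neg_T3 (n : Fin 3 → ℤ) (a : T3) : mFourier n (-a) = starRingEnd ℂ (mFourier n a) := by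
  rw [← mFourier_neg]
  simp only [mFourier, ContinuousMap.coe_mk, Pi.neg_apply, fourier_apply, zsmul_neg, neg_zsmul]

/-- Subtraction formula for the real Fourier monomial `Re e_n`:
`Re e_n(x − a) = Re e_n(x) Re e_n(a) + Im e_n(x) Im e_n(a)`. [folklore] -/
theorem re_mFourier_sub (n : Fin 3 → ℤ) (x a : T3) :
    (mFourier n (x - a)).re = (mFourier n x).re * (mFourier n a).re + (mFourier n x).im * (mFourier n a).im := by
  rw [sub_eq_add_neg, mFourier_apply_add_T3, mFourier_apply_neg_T3, Complex.mul_re, Complex.conj_re, Complex.conj_im]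
  ring

end Character

/-! ### Pointwise identity: the pair integral against two empirical measures is a sum of two products -/

section Pointwise

open UnitAddTorus

/-- **Inner empirical integral of the pair functional at `f = Re e_n`** (a finite sum, `integral_empiricalMeasure`):
for every one-particle state `y`,
`∫_{y'} Re e_n(y.1 − y'.1) Π(y.2) Π(y'.2) d(emp z)(y') = (Π(Re e_n)(z) · Re e_n(y.1) + Π(Im e_n)(z) · Im e_n(y.1)) · Π(y.2)`.
[folklore] -/
theorem stressPair_inner_eq {m : ℕ} (n : Fin 3 → ℤ) (z : Config m (Fin 3) T3) (y : T3 × V3) :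
    ∫ y', (mFourier n (y.1 - y'.1)).re * (y.2 0 * y.2 1) * (y'.2 0 * y'.2 1) ∂(empiricalMeasure z) =
      ((∫ y', (mFourier n y'.1).re * (y'.2 0 * y'.2 1) ∂(empiricalMeasure z)) * (mFourier n y.1).re +
        (∫ y', (mFourier n y'.1).im * (y'.2 0 * y'.2 1) ∂(empiricalMeasure z)) * (mFourier n y.1).im) *
        (y.2 0 * y.2 1) := by
  rw [integral_empiricalMeasure, integral_empiricalMeasure, integral_empiricalMeasure]
  simp only [re_mFourier_sub, Finset.mul_sum, Finset.sum_mul, add_mul, ← Finset.sum_add_distrib]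
  refine Finset.sum_congr rfl fun i _ => ?_
  ring

/-- **Pointwise pair identity**: for any two configurations `z'` (at the later time) and `z`,
`∫_y ∫_{y'} Re e_n(y.1 − y'.1) Π(y.2) Π(y'.2) d(emp z)(y') d(emp z')(y)
  = Π(Re e_n)(z') Π(Re e_n)(z) + Π(Im e_n)(z') Π(Im e_n)(z)` (finite sums and `re_mFourier_sub`). [folklore] -/
theorem stressPair_eq_re_mul_re_add_im_mul_im {m' m : ℕ} (n : Fin 3 → ℤ) (z' : Config m' (Fin 3) T3)
    (z : Config m (Fin 3) T3) :
    ∫ y, (∫ y', (mFourier n (y.1 - y'.1)).re * (y.2 0 * y.2 1) * (y'.2 0 * y'.2 1) ∂(empiricalMeasure z))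
        ∂(empiricalMeasure z') =
      (∫ y, (mFourier n y.1).re * (y.2 0 * y.2 1) ∂(empiricalMeasure z')) *
          (∫ y, (mFourier n y.1).re * (y.2 0 * y.2 1) ∂(empiricalMeasure z)) +
        (∫ y, (mFourier n y.1).im * (y.2 0 * y.2 1) ∂(empiricalMeasure z')) *
          (∫ y, (mFourier n y.1).im * (y.2 0 * y.2 1) ∂(empiricalMeasure z)) := by
  simp_rw [stressPair_inner_eq n z]
  rw [integral_empiricalMeasure z', integral_empiricalMeasure z', integral_empiricalMeasure z']
  simp only [Finset.mul_sum, Finset.sum_mul, add_mul, ← Finset.sum_add_distrib]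
  refine Finset.sum_congr rfl fun i _ => ?_
  ring

end Pointwise

/-! ### The registered stub -/

section Stub

open UnitAddTorus

/-- **Stub `stub_torusStressPairForm` (B3form)**: the finite-`N` Fourier/pair identity
`M_N(s; Re e_n, Re e_n) + M_N(s; Im e_n, Im e_n) = P_N(s; Re e_n)` for `σ ≤ 1/2`, `θ > 0`, every flow family `Φ`,
wavenumber `n ∈ ℤ³`, time `s` and `N` — the two-time kinetic shear-stress structure factor at wavenumber `n` is the
two-time stress pair functional tested against `Re e_n` (pointwise identity `stressPair_eq_re_mul_re_add_im_mul_im`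
integrated over `G_N`, `integral_add` with `integrable_stressField_flow_mul_of_continuous`). [folklore] -/
theorem stub_torusStressPairForm :
    ∀ σ : ℝ, 0 < σ → σ ≤ 1 / 2 → ∀ θ : ℝ, 0 < θ →
      ∀ Φ : (N : ℕ) → HardSphereFlow (Torus.geometry (Fin 3)) (hsDiameter σ N) (N + 1),
      ∀ (n : Fin 3 → ℤ) (s : ℝ) (N : ℕ),
        ((N : ℝ) + 1) * ∫ z, (∫ y, (UnitAddTorus.mFourier n y.1).re * (y.2 0 * y.2 1)
              ∂(empiricalMeasure ((Φ N).flow (s * ((N : ℝ) + 1) ^ (-(1 / 3 : ℝ))) z))) *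
            (∫ y, (UnitAddTorus.mFourier n y.1).re * (y.2 0 * y.2 1) ∂(empiricalMeasure z))
            ∂(localGibbsLaw σ (fun _ => 1) (fun _ => 0) (fun _ => θ) N (Φ N)) +
          ((N : ℝ) + 1) * ∫ z, (∫ y, (UnitAddTorus.mFourier n y.1).im * (y.2 0 * y.2 1)
              ∂(empiricalMeasure ((Φ N).flow (s * ((N : ℝ) + 1) ^ (-(1 / 3 : ℝ))) z))) *
            (∫ y, (UnitAddTorus.mFourier n y.1).im * (y.2 0 * y.2 1) ∂(empiricalMeasure z))
            ∂(localGibbsLaw σ (fun _ => 1) (fun _ => 0) (fun _ => θ) N (Φ N)) =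
        ((N : ℝ) + 1) * ∫ z, (∫ y, (∫ y', (UnitAddTorus.mFourier n (y.1 - y'.1)).re * (y.2 0 * y.2 1) * (y'.2 0 * y'.2 1)
              ∂(empiricalMeasure z)) ∂(empiricalMeasure ((Φ N).flow (s * ((N : ℝ) + 1) ^ (-(1 / 3 : ℝ))) z)))
            ∂(localGibbsLaw σ (fun _ => 1) (fun _ => 0) (fun _ => θ) N (Φ N)) := by
  intro σ _hσ0 hσ θ hθ Φ n s N
  set t : ℝ := s * ((N : ℝ) + 1) ^ (-(1 / 3 : ℝ)) with ht
  have iA := integrable_stressField_flow_mul_of_continuous hσ hθ N (Φ N) (continuous_re_mFourier n)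
    (continuous_re_mFourier n) t
  have iB := integrable_stressField_flow_mul_of_continuous hσ hθ N (Φ N) (continuous_im_mFourier n)
    (continuous_im_mFourier n) t
  rw [← mul_add, ← integral_add iA iB]
  congr 1
  refine integral_congr_ae (Eventually.of_forall fun z => ?_)
  exact (stressPair_eq_re_mul_re_add_im_mul_im n ((Φ N).flow t z) z).symm

end Stub

end Summit.AtomisticToContinuum.HydrodynamicLimit.Theorems.MourreKoopmanChargesStressStrongMixing

end
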